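import Summits.Ventures.YMGap.YM3IR.BalabanSUN
import Summits.Ventures.YMGap.RobustBall.TorusRowsYM3
import HarnessLib

/-!
# YM3IR / BalabanSU2 — the YM₃ promise sentence for `SU(2)` with EXACTLY ONE non-printed hypothesis
(UV side's instantiation × Y2's certified `d = 3` rows; theorems only)

HONEST FRAMING (cell pub-ymgap, track Y4 / YM3-IR, seat ym3ir-theory-1, gen 4).  This file claims NO summit, NO mass gap
and NO part of Bałaban's theorems.  It is kernel-checked BOOKKEEPING: the `SU(N)` composition of `YM3IR/BalabanSUN.lean`
(`massGap3Cofinal_suN_balaban_of_irConjecture3`) at `N = 2` with track Y2's input DISCHARGED by ds-2's HYPOTHESIS-FREE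
`d = 3` rows (`RobustBall/TorusRowsYM3.lean`: `su2_clusterDomainClustering_dim3_oneEighth r` — the receiving conjecture
`ClusterDomainClustering` for the ball spec ⟨fundamental `SU(2)`, Wilson ceiling `β⋆ = 1/16` (= `β_W = 1/8` in tree units
`β = β_W/N`), membership in `RobustBall.ClusterDomainFR (23/50) (23/100) r`⟩ at rate `−log ρ⋆/(r ⊔ 1)`,
`ρ⋆ = rhoFR 2 (3/8) (23/50) (23/100) < 1`, ONE constant `A = 16` for all tori `(ℤ/M)³`, `M ≥ 3`; and the `β_W = 1/4` row),
so that the end theorem has EXACTLY ONE hypothesis that is neither a printed theorem's `Prop`, nor a kernel-certified row,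
nor a positivity constant.  No axiom, no `sorry`, no `def`.

THE HYPOTHESIS LIST, VERBATIM (`massGap3Cofinal_su2_balaban_of_irConjecture3`):
* `BalabanUV3 mk` — IN PRINT (T. Bałaban, CMP 102 (1985), Thm 1 p. 257 + Thm 2 p. 272; the tree's `Prop`s over the abstract
  renormalization-group construction `mk : Construction L`);
* `Nonempty (Family L eps0)` — print's clauses at ONE coupling (p. 256 L15–18; `CarrierBridge.family_nonempty_of_pos`), or
  Theorem 2's own `ε₀` in the `printedOrder` form below;
* `0 < C_b`, `0 < κ` — positivity of the two bookkeeping constants of the conjecture;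
* `IRConjecture3 (ballOfRobustBallFR 2 (23/50) (23/100) r (1/16)) suFrobDist (fundamentalRep (Fin 2))
  (balabanCouplings L (suGroupModel 2) eps0) C_b κ` — the ONE CONJECTURE (NOT in print; theory-2, `Statement.lean`): ONE
  block family whose coarse laws, at every coupling of Bałaban's `SU(2)` family, have block factor `b(β) ≤ C_b β` and are
  members of Y2's certified tier-1 ball (Wilson part at coupling `≤ 1/16`, perturbation in `ClusterDomainFR (23/50) (23/100) r`),
  with fluctuation fields massive at rate `κ`.
CONCLUSION: `MassGap3Cofinal (balabanCouplings L (suGroupModel 2) eps0) suFrobDist (fundamentalRep (Fin 2))` — volume-uniform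
exponential clustering of the fine `SU(2)` Wilson laws in `d = 3` at rate `m₀/β` (`m₀ > 0`) on the block family's tori, at
every coupling of Bałaban's unbounded coupling set `{L^K/(2 g² ε₀(g))}`.  A LATTICE statement; no continuum limit, no
Millennium claim; `Y2`'s input is a STRONG-coupling certificate (`β_W ≤ 1/8`), the crossover down to it is the conjecture.

WHY THIS IS NOVEL (one sentence).  For the first time the sentence «Bałaban's printed UV stability + a certified
strong-coupling cluster expansion + ONE named crossover conjecture ⟹ the `SU(2)` lattice YM₃ mass gap on Bałaban's coupling
set» is a single kernel-checked implication in which the strong-coupling input is a THEOREM with explicit constants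
(`β_W = 1/8`, `ε = 23/100`, `A = 16`, rate `−log 0.98…/(r ⊔ 1)`) rather than a citation, and the counted crossover it leaves
to the conjecture is explicit (`L^{M'} ≥ 8/γ₀²`, `BalabanSUN.su2_betaTree_div_pow_le_sixteenth_iff`).

References: T. Bałaban, CMP 102 (1985) 255–275, p. 256 L15–18, Thm 1 p. 257, Thm 2 p. 272 [cite: Balaban1985UV3];
K. Osterwalder, E. Seiler, Ann. Phys. 110 (1978) 440, §3 (the Wilson member of the ball, in print)
[cite: OsterwalderSeilerAnnPhys1978]; H. Föllmer, LNM 1362 (1988) Ch. I (2.14)/(2.24) [cite: Follmer1988].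
-/

noncomputable section

open MeasureTheory
open Literature.MathematicalPhysics.QuantumLattice Literature.MathematicalPhysics.QuantumFieldTheory
open Balaban1985CMP102 Balaban1985CMP102.Setting Balaban1985CMP102.Theorems
open Literature.MathematicalPhysics.QuantumFieldTheory.Balaban1983to89 (GaugeGroup HaarData)
open Summit.QuantumFields.Balaban3D.Carriers (suGroupModel)

namespace Summit.Ventures.YMGap.YM3IR

open CarrierBridge

/-- The rate of ds-2's `d = 3` row `(β_W, ε) = (1/8, 23/100)` is positive, in the row's own elaborated form
`−log ρ⋆ / ↑(max r 1)`. [folklore] -/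
theorem su2_dim3_oneEighth_rate_pos' (r : ℕ) :
    0 < -Real.log (RobustBall.rhoFR 2 (3 / 8) (23 / 50) (23 / 100)) / ((max r 1 : ℕ) : ℝ) :=
  rate_pos_of_rhoFR r (RobustBall.rhoFR_pos (by norm_num) (by norm_num)) RobustBall.rhoFR_su2_dim3_oneEighth_lt_one

/-- The rate of ds-2's `d = 3` row `(β_W, ε) = (1/4, 3/50)` is positive, in the row's own elaborated form. [folklore] -/
theorem su2_dim3_oneQuarter_rate_pos' (r : ℕ) :
    0 < -Real.log (RobustBall.rhoFR 2 (3 / 4) (3 / 25) (3 / 50)) / ((max r 1 : ℕ) : ℝ) :=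
  rate_pos_of_rhoFR r (RobustBall.rhoFR_pos (by norm_num) (by norm_num)) RobustBall.rhoFR_su2_dim3_oneQuarter_lt_one

/-- **`SU(2)` lattice YM₃ mass gap on Bałaban's coupling set: print ∧ ONE conjecture, Y2's input CERTIFIED (PROVED
bookkeeping).**  `Nonempty (Family L eps0) → 0 < C_b → 0 < κ → BalabanUV3 mk → IRConjecture3 (ballOfRobustBallFR 2 (23/50)
(23/100) r (1/16)) suFrobDist ρ_fund (balabanCouplings L (suGroupModel 2) eps0) C_b κ → MassGap3Cofinal (balabanCouplings L
(suGroupModel 2) eps0) suFrobDist ρ_fund` — the receiving conjecture `ClusterDomainClustering` and the rate positivity are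
ds-2's hypothesis-free row `RobustBall.su2_clusterDomainClustering_dim3_oneEighth r` (β_W = 1/8, ε = 23/100, any finite
range `r`), consumed BY NAME. EXACTLY ONE hypothesis is not in print / not certified: `IRConjecture3`.
[cite: Balaban1985UV3, Thm 1 p.257; Thm 2 p.272] -/
theorem massGap3Cofinal_su2_balaban_of_irConjecture3 {L : ℕ} {mk : Construction L} {eps0 : ℝ → ℝ}
    (hfam : Nonempty (Family L eps0)) (r : ℕ) {C_b κ : ℝ} (hC : 0 < C_b) (hκ : 0 < κ) (hUV : BalabanUV3 mk)
    (hIR : IRConjecture3 (ballOfRobustBallFR 2 (23 / 50) (23 / 100) r (1 / 16)) suFrobDist (fundamentalRep (Fin 2))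
      (balabanCouplings L (suGroupModel 2) eps0) C_b κ) :
    MassGap3Cofinal (balabanCouplings L (suGroupModel 2) eps0) suFrobDist
      (fundamentalRep (Fin 2) : RobustBall.SUN 2 →* Matrix (Fin 2) (Fin 2) ℂ) :=
  massGap3Cofinal_suN_balaban_of_irConjecture3 hfam hC hκ (su2_dim3_oneEighth_rate_pos' r) hUV
    (RobustBall.su2_clusterDomainClustering_dim3_oneEighth r) hIR

/-- **The same on Y2's `β_W = 1/4` row** (ceiling `β⋆ = 1/8` in tree units, thinner ball `ClusterDomainFR (3/25) (3/50) r`;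
PROVED bookkeeping on `RobustBall.su2_clusterDomainClustering_dim3_oneQuarter r`): a higher Wilson ceiling leaves the
conjecture fewer crossover steps (`L^{M'} ≥ 4/γ₀²`) at the price of a smaller perturbation ball.
[cite: Balaban1985UV3, Thm 1 p.257; Thm 2 p.272] -/
theorem massGap3Cofinal_su2_balaban_quarterRow_of_irConjecture3 {L : ℕ} {mk : Construction L} {eps0 : ℝ → ℝ}
    (hfam : Nonempty (Family L eps0)) (r : ℕ) {C_b κ : ℝ} (hC : 0 < C_b) (hκ : 0 < κ) (hUV : BalabanUV3 mk)
    (hIR : IRConjecture3 (ballOfRobustBallFR 2 (3 / 25) (3 / 50) r (1 / 8)) suFrobDist (fundamentalRep (Fin 2))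
      (balabanCouplings L (suGroupModel 2) eps0) C_b κ) :
    MassGap3Cofinal (balabanCouplings L (suGroupModel 2) eps0) suFrobDist
      (fundamentalRep (Fin 2) : RobustBall.SUN 2 →* Matrix (Fin 2) (Fin 2) ℂ) :=
  massGap3Cofinal_suN_balaban_of_irConjecture3 hfam hC hκ (su2_dim3_oneQuarter_rate_pos' r) hUV
    (RobustBall.su2_clusterDomainClustering_dim3_oneQuarter r) hIR

/-- **In PRINT'S quantifier order (PROVED bookkeeping):** from `BalabanUV3 mk`, at THEOREM 2's own terminal spacing `ε₀`
for `SU(2)` (positive on `g > 0`; inequalities (41)/(45)–(47) along the family): for every finite range `r` and positive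
`C_b, κ`, `Nonempty (Family L eps0) → IRConjecture3 (ballOfRobustBallFR 2 (23/50) (23/100) r (1/16)) … → MassGap3Cofinal …`.
The IR side receives `ε₀`; Y2's input is certified; ONE conjecture remains. [cite: Balaban1985UV3, p.256 L15–18; Thm 2 p.272] -/
theorem massGap3Cofinal_su2_balaban_printedOrder_of_irConjecture3 {L : ℕ} (mk : Construction L)
    (hUV : BalabanUV3 mk) :
    ∃ eps0 : ℝ → ℝ, (∀ g : ℝ, 0 < g → 0 < eps0 g) ∧
      (∀ S : Family L eps0, ∀ k, k ≤ S.1.K → (mk (RobustBall.SUN 2) (suGroupModel 2) S.1).ineq41_47 k) ∧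
      ∀ (r : ℕ) (C_b κ : ℝ), 0 < C_b → 0 < κ → Nonempty (Family L eps0) →
        IRConjecture3 (ballOfRobustBallFR 2 (23 / 50) (23 / 100) r (1 / 16)) suFrobDist (fundamentalRep (Fin 2))
          (balabanCouplings L (suGroupModel 2) eps0) C_b κ →
          MassGap3Cofinal (balabanCouplings L (suGroupModel 2) eps0) suFrobDist
            (fundamentalRep (Fin 2) : RobustBall.SUN 2 →* Matrix (Fin 2) (Fin 2) ℂ) := by
  obtain ⟨eps0, hpos, h2, h⟩ := massGap3Cofinal_suN_balaban_printedOrder_of_irConjecture3 (N := 2) mk hUV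
  exact ⟨eps0, hpos, h2, fun r C_b κ hC hκ hfam hIR =>
    h (ballOfRobustBallFR 2 (23 / 50) (23 / 100) r (1 / 16)) C_b κ _ hC hκ (su2_dim3_oneEighth_rate_pos' r) hfam
      (RobustBall.su2_clusterDomainClustering_dim3_oneEighth r) hIR⟩

/-- **The conjecture's counted task on this row (PROVED arithmetic):** a member of Bałaban's `SU(2)` family whose
canonical-scaling coupling after `K + M'` steps lies in this row's Wilson window (`≤ 1/16`) has `L^{M'} ≥ 8/γ₀² ≥ 8` —
`IRConjecture3` on this ball must control at least `⌈log_L 8⌉` blockings at `O(1)` coupling beyond Bałaban's `K`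
(`BalabanSUN.su2_eight_le_pow_of_betaTree_div_pow_le_sixteenth`, restated at the row's ball for the record).
[cite: Balaban1985UV3, (5) p.256] -/
theorem su2_row_oneEighth_crossover_steps {L : ℕ} (S : Scales L) (M' : ℕ)
    (h : betaTree (suGroupModel 2) S / (L : ℝ) ^ (S.K + M') ≤ (ballOfRobustBallFR 2 (23 / 50) (23 / 100) 0 (1 / 16)).βstar) :
    (8 : ℝ) ≤ (L : ℝ) ^ M' :=
  su2_eight_le_pow_of_betaTree_div_pow_le_sixteenth S M' h

end Summit.Ventures.YMGap.YM3IR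

end
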